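import Summits.QuantumFields.QCD.Theorems.NestedDissectionSeaEarlyCrosserLawNormalForm
import Summits.QuantumFields.QCD.Theorems.NestedDissectionSeaEarlyCrosserLawMeanCountReduction
import Summits.QuantumFields.QCD.Theorems.NestedDissectionSeaEarlyCrosserLawReduction
import Summits.QuantumFields.QCD.Theorems.NestedDissectionSeaEarlyCrosserLawCoverReduction

/-!
# Normal-form links for clause (a′) of the crux `EarlyCrosserLaw` (stmt-QuantumFields-13995)

Normal-form links: the three transferred (a′)-laws of the lines `accretive-coarse-jensen` (Jensen law /
mean-count law) and `kac-rice-hermitian-dos` (cover law) give `CoverProbClause` directly, and Form B‴ —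
ONE shared physics node on the physical branch (`CoverProbClause ∧ PinClause ∧ UpperPin` with its
`∃ reg` and `mcrit → 0`) gives the crux BY NAME (lead c3/c4 registered, lead c5 landed).

Each of the three built lines of the crux transferred its physics law `X` at fixed data
`(N_f, reg, b₀, ℓ, m, R)` into clause (a′) of the crux (`dilution_of_X : X-law → (a′)`, same data, same
`δ`): `AccretiveCoarseJensen.dilution_of_jensenLaw` (two-circle Jensen excess),
`AccretiveCoarseJensen.dilution_of_meanCountLaw` (mean number of early real crossers) and
`KacRiceHermitianDos.dilution_of_coverLaw` (pseudospectral cover law).  The landed NORMAL FORM of (a′)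
(`NormalForm.dilutionClause_iff_coverProbClause`: (a′) `DilutionClause` is equivalent to the single
inequality `P(CoverEvent) ≤ δ_j` per window box, `CoverProbClause`) turns each of these transfers into a
direct implication `X-law → CoverProbClause`:

* `coverProbClause_of_meanCountLaw`, `coverProbClause_of_jensenLaw`, `coverProbClause_of_coverLaw`.

Finally `EarlyCrosserLaw_of_pinnedCoverLawOnBranch` (Form B‴) records that ONE merged physics statement
on the physical branch — one admissible regularisation with `m_crit(k) → 0`, `M₀`, `b₀`, `ℓ`, and for
every mass tuple above `M₀` one `R` carrying `CoverProbClause ∧ PinClause ∧ UpperPin` — gives the crux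
by name (`NormalForm.earlyCrosserLaw_iff_coverProb`, forgetting the branch conjunct).

Pure logic over landed theorems; no physics is proved here. [folklore]
-/

noncomputable section

open scoped BigOperators Classical Matrix
open Filter MeasureTheory
open Literature.MathematicalPhysics.QuantumLattice Literature.MathematicalPhysics.QuantumFieldTheory
  Literature.Probability.LatticeModels
open Summit.QuantumFields.QCD.Theses.NestedDissectionSea
open Summit.QuantumFields.QCD.Theorems.EarlyCrosserLawNegative
open Summit.QuantumFields.QCD.Theorems.CoerciveSeaNegative

namespace Summit.QuantumFields.QCD.Cruxes.EarlyCrosserLaw.NormalForm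

/-! ## The three transferred (a′)-laws feed the normal form -/

/-- **Mean-count law ⇒ normal form of (a′).**  The mean-count law of line `accretive-coarse-jensen`
(window-summable phase-quenched MEAN NUMBER of early real crossers of the corner-`0` window cell and its
sixteen children, `AccretiveCoarseJensen.dilution_of_meanCountLaw`) at fixed `(N_f, reg, b₀, ℓ, m, R)`
gives `CoverProbClause` at the same data. [folklore] -/
theorem coverProbClause_of_meanCountLaw {Nf : ℕ} (reg : QCDRegularisation Nf) (b₀ : ℕ) (ℓ : ℝ)
    (m : Fin Nf → ℝ) (R : ℝ)
    (hMC : (∀ ε : ℝ, 0 < ε → ∀ᶠ k : ℕ in Filter.atTop, ∀ S : ℕ, R ≤ reg.a k * (2 * S + 1) →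
      ∃ δ : ℕ → ℝ, (∀ j, 0 ≤ δ j) ∧
        ∑ j ∈ Finset.range (Nat.log 2 (⌊ℓ / reg.a k⌋₊ / b₀) + 1), δ j ≤ ε ∧
        ∀ j < Nat.log 2 (⌊ℓ / reg.a k⌋₊ / b₀) + 1, ∀ s : Fin 4 → ℕ,
          (∀ i, b₀ * 2 ^ j ≤ s i ∧ s i < b₀ * 2 ^ (j + 2) ∧ s i ≤ 2 * S + 1 ∧
            (s i : ℝ) * reg.a k ≤ ℓ) →
          (∫ U, (∑ f, ((realSpecCount (wilsonCell U 0 (0 : TorusSite 4 (2 * S + 1)) s)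
                (-(reg.mcrit k + reg.a k * m f / reg.Zm k)) : ℝ) +
              ∑ c : Fin 4 → Bool, (realSpecCount (wilsonCell U 0 (halfCorner s c) (halfSides s c))
                (-(reg.mcrit k + reg.a k * m f / reg.Zm k)) : ℝ))) *
              (∏ f, ‖fermionDet (wilsonDirac (fundamentalRep (Fin 3)) U
                (reg.mcrit k + reg.a k * m f / reg.Zm k) 1)‖)
            ∂(wilsonMeasure (fundamentalRep (Fin 3)) (reg.β k) :
              Measure (GaugeConfig 4 (2 * S + 1) (Matrix.specialUnitaryGroup (Fin 3) ℂ)))) /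
          (∫ U, (∏ f, ‖fermionDet (wilsonDirac (fundamentalRep (Fin 3)) U
                (reg.mcrit k + reg.a k * m f / reg.Zm k) 1)‖)
            ∂(wilsonMeasure (fundamentalRep (Fin 3)) (reg.β k) :
              Measure (GaugeConfig 4 (2 * S + 1) (Matrix.specialUnitaryGroup (Fin 3) ℂ)))) ≤ δ j)) :
    CoverProbClause Nf reg b₀ ℓ m R :=
  (dilutionClause_iff_coverProbClause Nf reg b₀ ℓ m R).mp
    (AccretiveCoarseJensen.dilution_of_meanCountLaw reg b₀ ℓ m R hMC)

/-- **Jensen law ⇒ normal form of (a′).**  The Jensen law of line `accretive-coarse-jensen`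
(window-summable phase-quenched two-circle Jensen excess of the characteristic polynomials of the
corner-`0` window cell and its sixteen children on the early grid, any radii `r_f > 0`,
`AccretiveCoarseJensen.dilution_of_jensenLaw`) at fixed `(N_f, reg, b₀, ℓ, m, R)` gives
`CoverProbClause` at the same data. [folklore] -/
theorem coverProbClause_of_jensenLaw {Nf : ℕ} (reg : QCDRegularisation Nf) (b₀ : ℕ) (ℓ : ℝ)
    (m : Fin Nf → ℝ) (R : ℝ)
    (hJL : (∀ ε : ℝ, 0 < ε → ∀ᶠ k : ℕ in Filter.atTop, ∀ S : ℕ, R ≤ reg.a k * (2 * S + 1) →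
      ∃ δ : ℕ → ℝ, (∀ j, 0 ≤ δ j) ∧
        ∑ j ∈ Finset.range (Nat.log 2 (⌊ℓ / reg.a k⌋₊ / b₀) + 1), δ j ≤ ε ∧
        ∀ j < Nat.log 2 (⌊ℓ / reg.a k⌋₊ / b₀) + 1, ∀ s : Fin 4 → ℕ,
          (∀ i, b₀ * 2 ^ j ≤ s i ∧ s i < b₀ * 2 ^ (j + 2) ∧ s i ≤ 2 * S + 1 ∧
            (s i : ℝ) * reg.a k ≤ ℓ) →
          ∃ r : Fin Nf → ℝ, (∀ f, 0 < r f) ∧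
            (∫ U, (∑ f, ∑ n ∈ Finset.range
                (⌊(-(reg.mcrit k + reg.a k * m f / reg.Zm k)) / (2 * r f)⌋₊ + 1),
                ((Real.circleAverage (fun z : ℂ =>
                    Real.log ‖((wilsonCell U 0 (0 : TorusSite 4 (2 * S + 1)) s).charpoly).eval z‖)
                    ((((2 * (n : ℝ) + 1) * r f : ℝ)) : ℂ) (2 * r f) -
                  Real.circleAverage (fun z : ℂ =>
                    Real.log ‖((wilsonCell U 0 (0 : TorusSite 4 (2 * S + 1)) s).charpoly).eval z‖)
                    ((((2 * (n : ℝ) + 1) * r f : ℝ)) : ℂ) (r f)) +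
                  ∑ ε : Fin 4 → Bool,
                    (Real.circleAverage (fun z : ℂ =>
                      Real.log ‖((wilsonCell U 0 (halfCorner s ε) (halfSides s ε)).charpoly).eval z‖)
                      ((((2 * (n : ℝ) + 1) * r f : ℝ)) : ℂ) (2 * r f) -
                    Real.circleAverage (fun z : ℂ =>
                      Real.log ‖((wilsonCell U 0 (halfCorner s ε) (halfSides s ε)).charpoly).eval z‖)
                      ((((2 * (n : ℝ) + 1) * r f : ℝ)) : ℂ) (r f)))) *
                (∏ f, ‖fermionDet (wilsonDirac (fundamentalRep (Fin 3)) U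
                  (reg.mcrit k + reg.a k * m f / reg.Zm k) 1)‖)
              ∂(wilsonMeasure (fundamentalRep (Fin 3)) (reg.β k) :
                Measure (GaugeConfig 4 (2 * S + 1) (Matrix.specialUnitaryGroup (Fin 3) ℂ)))) /
            (∫ U, (∏ f, ‖fermionDet (wilsonDirac (fundamentalRep (Fin 3)) U
                  (reg.mcrit k + reg.a k * m f / reg.Zm k) 1)‖)
              ∂(wilsonMeasure (fundamentalRep (Fin 3)) (reg.β k) :
                Measure (GaugeConfig 4 (2 * S + 1) (Matrix.specialUnitaryGroup (Fin 3) ℂ)))) ≤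
            δ j * Real.log 2)) :
    CoverProbClause Nf reg b₀ ℓ m R :=
  (dilutionClause_iff_coverProbClause Nf reg b₀ ℓ m R).mp
    (AccretiveCoarseJensen.dilution_of_jensenLaw reg b₀ ℓ m R hJL)

/-- **Cover law ⇒ normal form of (a′).**  The pseudospectral cover law of line `kac-rice-hermitian-dos`
(for every window cell a finite cover of the early mass interval by quasimode windows whose summed
phase-quenched quasimode probabilities are window-summable, `KacRiceHermitianDos.dilution_of_coverLaw`,
`b₀ ≥ 2`) at fixed `(N_f, reg, b₀, ℓ, m, R)` gives `CoverProbClause` at the same data. [folklore] -/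
theorem coverProbClause_of_coverLaw {Nf : ℕ} (reg : QCDRegularisation Nf) (b₀ : ℕ) (hb₀ : 2 ≤ b₀)
    (ℓ : ℝ) (m : Fin Nf → ℝ) (R : ℝ)
    (hcc : ∀ ε : ℝ, 0 < ε → ∀ᶠ k : ℕ in Filter.atTop, ∀ S : ℕ, R ≤ reg.a k * (2 * S + 1) →
      ∃ δ : ℕ → ℝ, (∀ j, 0 ≤ δ j) ∧
        ∑ j ∈ Finset.range (Nat.log 2 (⌊ℓ / reg.a k⌋₊ / b₀) + 1), δ j ≤ ε ∧
        ∀ j < Nat.log 2 (⌊ℓ / reg.a k⌋₊ / b₀) + 1, ∀ s : Fin 4 → ℕ,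
          (∀ i, b₀ * 2 ^ j ≤ s i ∧ s i < b₀ * 2 ^ (j + 2) ∧ s i ≤ 2 * S + 1 ∧
            (s i : ℝ) * reg.a k ≤ ℓ) →
          ∃ n : ℕ, ∃ μc ηc : Fin n → ℝ,
            (∀ f : Fin Nf, ∀ t : ℝ, reg.mcrit k + reg.a k * m f / reg.Zm k ≤ t →
              t ≤ -(∑ i, (1 - Real.cos (Real.pi / s i))) → ∃ i : Fin n, |t - μc i| ≤ ηc i) ∧
            ∑ i : Fin n,
              ((∫ U, (if (∃ w : {p // wilsonBox (0 : TorusSite 4 (2 * S + 1)) s p} → ℂ, w ≠ 0 ∧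
                    ∑ p, ‖(wilsonCell U (μc i) 0 s *ᵥ w) p‖ ^ 2 ≤ ηc i ^ 2 * ∑ p, ‖w p‖ ^ 2)
                    then (1 : ℝ) else 0) *
                  (∏ f, ‖fermionDet (wilsonDirac (fundamentalRep (Fin 3)) U
                    (reg.mcrit k + reg.a k * m f / reg.Zm k) 1)‖)
                ∂(wilsonMeasure (fundamentalRep (Fin 3)) (reg.β k) :
                  Measure (GaugeConfig 4 (2 * S + 1) SU3))) /
              (∫ U, (∏ f, ‖fermionDet (wilsonDirac (fundamentalRep (Fin 3)) U
                    (reg.mcrit k + reg.a k * m f / reg.Zm k) 1)‖)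
                ∂(wilsonMeasure (fundamentalRep (Fin 3)) (reg.β k) :
                  Measure (GaugeConfig 4 (2 * S + 1) SU3))) +
              ∑ c : Fin 4 → Bool,
                (∫ U, (if (∃ w : {p // wilsonBox (halfCorner s c) (halfSides s c) p} → ℂ, w ≠ 0 ∧
                    ∑ p, ‖(wilsonCell U (μc i) (halfCorner s c) (halfSides s c) *ᵥ w) p‖ ^ 2 ≤
                      ηc i ^ 2 * ∑ p, ‖w p‖ ^ 2) then (1 : ℝ) else 0) *
                  (∏ f, ‖fermionDet (wilsonDirac (fundamentalRep (Fin 3)) U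
                    (reg.mcrit k + reg.a k * m f / reg.Zm k) 1)‖)
                ∂(wilsonMeasure (fundamentalRep (Fin 3)) (reg.β k) :
                  Measure (GaugeConfig 4 (2 * S + 1) SU3))) /
              (∫ U, (∏ f, ‖fermionDet (wilsonDirac (fundamentalRep (Fin 3)) U
                    (reg.mcrit k + reg.a k * m f / reg.Zm k) 1)‖)
                ∂(wilsonMeasure (fundamentalRep (Fin 3)) (reg.β k) :
                  Measure (GaugeConfig 4 (2 * S + 1) SU3)))) ≤ δ j) :
    CoverProbClause Nf reg b₀ ℓ m R :=
  (dilutionClause_iff_coverProbClause Nf reg b₀ ℓ m R).mp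
    (KacRiceHermitianDos.dilution_of_coverLaw reg b₀ hb₀ ℓ m R hcc)

/-! ## Form B‴: the crux by name from ONE shared physics node on the physical branch -/

/-- **Form B‴ — the crux BY NAME from one merged physics statement on the physical branch.**  If for
`N_f ∈ {2, 3}` ONE admissible regularisation on the physical branch (`m_crit(k) → 0`) carries `M₀ ≥ 0`,
`b₀ ≥ 2`, `ℓ > 0` and, for every mass tuple `m > M₀`, one `R > 0` with the cover-probability clause
(normal form of (a′)), the lower pin (b) and the upper pin (b″), then `EarlyCrosserLaw` holds
(`earlyCrosserLaw_iff_coverProb`; the branch conjunct is forgotten). [folklore] -/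
theorem EarlyCrosserLaw_of_pinnedCoverLawOnBranch
    (h : ∀ Nf : ℕ, (Nf = 2 ∨ Nf = 3) → ∃ reg : QCDRegularisation Nf, reg.HasMassScaling ∧
      (reg.scheme 0 0 0).HasAsymptoticScaling ∧ Filter.Tendsto reg.mcrit Filter.atTop (nhds 0) ∧
      ∃ M₀ : ℝ, 0 ≤ M₀ ∧ ∃ b₀ : ℕ, 2 ≤ b₀ ∧ ∃ ℓ : ℝ, 0 < ℓ ∧ ∀ m : Fin Nf → ℝ, (∀ f, M₀ < m f) →
        ∃ R : ℝ, 0 < R ∧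
          CoverProbClause Nf reg b₀ ℓ m R ∧ PinClause Nf reg M₀ m R ∧ UpperPin Nf reg M₀ m R) :
    EarlyCrosserLaw :=
  earlyCrosserLaw_iff_coverProb.mpr fun Nf hNf => by
    obtain ⟨reg, hms, has, -, hrest⟩ := h Nf hNf
    exact ⟨reg, hms, has, hrest⟩

end Summit.QuantumFields.QCD.Cruxes.EarlyCrosserLaw.NormalForm

end
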